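import Summits.QuantumFields.BalabanUV.Beta.GAN24.CombForcingTransport
import Summits.QuantumFields.BalabanUV.Beta.GAN24.DressedSourceZeroModeWords

/-!
# `BalabanUV.Beta.GAN24.CombForcingTwoFaceWords` — binder row G-an2-4 ∕ (CONV-C), TRANSFER-III, the (III′) (C)-campaign's supplier `hB0` (memo M-1 §2): **leaf-04's 21 AT THE COMB
# DATA — THE ff CELL CHARGE OF THE COMB-CHART FORCING IS A CELL-AND-LATTICE SUM OF THREE TWO-FACE WORDS OF THE bm CHART ON 𝒯-TRANSPORTED TABLES**
# (G-an2-4 CRUX TEAM (2), leaf prover `b2b-balaban-gan24-formalise-leaf-01`, gen 85; journal [LEAF01-G85-INTENT-2])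

NOT IN PRINT; OUR BOOKKEEPING ([folklore] ONE `rw` + ONE `exact`: leaf-01 g85's `CombForcingTransport.zmode_combForcing_eq_bm_transport` ((Q1) for the forcing) ⨾ leaf-04 g66's 21
`DressedSourceZeroModeWords.zmode_dressedSource_inl_inl` (GENERIC in the tables; reads the bm kernel `X̃♮ = unitK s_f s_m (coDressKBmAt ρ Lc (KInvStep Lc j))` pointwise through (E0)
`DressedStepFaceCharges`), its two sockets `hb ∕ hW` discharged for the TRANSPORTED comb tables by §1's transport sockets (road-P2 M.43 `locStencil_transportPsiS` pattern:
`biLoc_comp_decays` ⨾ `biLoc_comp_right` with the spread `Ψ̂_S`, `Ψ̂_Sᵀ`) and d1-leaf-03's `loc_dM_of_spr` ∕ an1's `vertexFamily₂_W2SymOfK'`; 0 `def`, 0 cited fact, 0 `def … : Prop`, 0 sorry).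
HONEST FRAMING (cell contract, verbatim): «discharging `BetaPertH` makes Bałaban's UV stability UNCONDITIONAL — a real constructive-QFT result; it is NOT the continuum limit and NOT
the Clay problem.»  HONEST DEPENDENCY (verbatim): «continuum YM on T⁴ ⇐ BetaPertH ∧ nine spine estimates (0/9 proved); BetaPertH ⇐ (D1) ∧ (D4) ∧ CAP+tail; G-an2-4 gates asym, D1
and NE2/3/4.»

## What is proved (generic `d`; notation of `CombForcingTransport`: `Ψ̂_S = psiKS (ctrOff (d+1) Lc) Lc`, `ρ_c = ctr (d+1) Lc = toSite (ctrOff (d+1) Lc)` (`rfl`),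
## `X̃_i = unitK s_f s_m (coDressKBmAt ρ_c Lc (KInvStep Lc i))`, `𝒯S κ u := Ψ̂_Sᵀ∘slotPsiS S κ u∘Ψ̂_S`, `𝒯′M ρ w := Ψ̂_Sᵀ∘M ρ w∘Ψ̂_S`, `𝒯₂M₂ κ u ρ w := Ψ̂_Sᵀ∘(slotPsiS M₂) κ u ρ w∘Ψ̂_S`)
* §1 TRANSPORT SOCKETS (generic `0 < n`, `r ∈ box (d+1) n`): **`vertexFamily_transport`** (`VertexFamily M n` ⟹ `VertexFamily (𝒯′M) n`, explicit constant, rate `δ∕4`),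
  **`locStencilFM_transport`** (`LocStencilFM n M₂` ⟹ `LocStencilFM n (𝒯₂M₂)`, rate `δ∕4`); at the comb data with units: `exists_locStencil_transport_S`, `exists_vertexFamily_transport_M`,
  `exists_locStencilFM_transport_M₂`, `spr_unitK_bm` — the four sockets of the bm functional on the transported comb tables; **`loc_dM_bm_transport`** (21's `hb`) and
  **`loc_W2SymOfK_bm_transport`** (21's `hW`, the transported forcing carrier).
* §2 **`zmode_combForcing_inl_inl`** (ANY `tabs : SymTables d Lc`, ANY units, pins, scalars `c cB`, ANY border `B` with zero ff block, every level `i`, period `N`, directions `μ ν α β`):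
  `zmode N (c • mmRead Lc (K3OfK X̃′_i Lc S̃′_i M̃′_i (W2SymOfK X̃′_i Lc S̃′_i M̃′_i 0 M̃₂′_i)) + cB • B) (μ,ν; inl α, inl β)
     = c·(−(s_f s_m σ_i)²·Lc²)·Σ_{u ∈ box N} Σ'_{u′} ( FF[(dM_{(μ,u)} ∘ X̃_i) ∘ dM_{(ν,u′)}] + FF[(dM_{(ν,u′)} ∘ X̃_i) ∘ dM_{(μ,u)}] − FF[W̃_{(μ,u)(ν,u′)}] )`
  with `dM_b = dM X̃_i Lc (𝒯S̃′_i) (𝒯′M̃′_i) b`, `W̃ = W2SymOfK X̃_i Lc (𝒯S̃′_i) (𝒯′M̃′_i) 0 (𝒯₂M̃₂′_i)`, `σ_i = (Lc^{i+1})^{−(d+2)}`, `FF[V] = Σ'_{(y,w)} 𝟙f(y_α)𝟙f(w_β)·V y w (inl α)(inl β)` — leaf-04's 21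
  VERBATIM at the centre root on the transported comb tables; **`zmode_combForcing_an1_inl_inl`** — `d = 3`, the wall's units, an1's record, `c = cE₂·Lc^{2(3+1)}`, `B = tabs.vh₂S` (the
  OWNER's (J) ∕ `hB0` tokens; the border's ff block is zero by an1's `symVh₂SAn1_inl_inl`).
WHAT THIS IS NOT: NOT `hB0`; the three words are NOT evaluated (33_j's sector split ∕ (L3c) ∕ the EE words at the comb data are the campaign); NO value of any table or charge; NOT
(d′)∕(d″); the (III′) campaign is NOT asked (an2 W-4); NEVER «G-an2-4 closed» as (CONV-C); NOT D1, NOT `BetaPertH`, NOT continuum, NOT Clay.  2026-08-27; no existing file touched.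
-/

noncomputable section

open Finset
open scoped BigOperators
open Literature.MathematicalPhysics.QuantumFieldTheory
open Literature.MathematicalPhysics.QuantumFieldTheory.Balaban1983to89
open Literature.MathematicalPhysics.QuantumFieldTheory.Balaban1983to89.Beta
open B12Sec2to5 (l1 l1_nonneg)
open ExpKernelCalculus (Site MKer Decays BiLoc VertexFamily VertexFamily₂ comp Zl Zl_nonneg biLoc_comp_decays)
open OneStepResolventKernel (Fib LocStencil biLoc_mono)
open OneStepKernelFamily (KInvStep)
open AffineAveraging (box toSite)
open AveragingContoursRooted (ctr ctrOff ctrOff_mem_box)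
open BalabanCompositeJets (LocStencil₂)
open BalabanStepJetsSucc (mmRead biLoc_comp_right)
open SecondOrderResponse (dM W2SymOfK LocStencilFM vertexFamily₂_W2SymOfK')
open BalabanStepW2 (K3OfK M2Of)
open Summit.QuantumFields.BalabanUV.Beta.TameKernelCalculus
open Summit.QuantumFields.BalabanUV.Beta.AxialDressingRooted (coDressKBmAt decays_coDressKBmAt_KInvStep)
open Summit.QuantumFields.BalabanUV.Beta.HessKerDressedUnits (unitK unitS decays_unitK)
open Summit.QuantumFields.BalabanUV.Beta.SecondOrderUnits (unitM unitM₂)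
open Summit.QuantumFields.BalabanUV.Beta.SymmetrisedStepJets (SymTables)
open Summit.QuantumFields.BalabanUV.Beta.SymSecondOrderTablesAn1 (symTablesAn1S2 symVh₂SAn1_inl_inl)
open Summit.QuantumFields.BalabanUV.Beta.CombChartStepJets (GcombSh SpureCombOf)
open Summit.QuantumFields.BalabanUV.Beta.SymCorrectorKernel (psiKS spr_psiKS)
open Summit.QuantumFields.BalabanUV.Beta.SymCorrectorFace (slotPsiS)
open Summit.QuantumFields.BalabanUV.Beta.SymCorrectorLiteralW (loc_dM_of_spr)
open Summit.QuantumFields.BalabanUV.Beta.SymCorrectorLiteralLoc (locStencilFM_slotPsiS loc_of_vertexFamily₂)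
open Summit.QuantumFields.BalabanUV.Beta.GAN24.CombCubicStepTransport (locStencil_transportPsiS)
open Summit.QuantumFields.BalabanUV.Beta.GAN24.CombForcingPairForm (exists_locStencil_unitS_SpureCombOf exists_vertexFamily_unitM_tabs exists_locStencilFM_unitM₂_M2Of_tabs)
open Summit.QuantumFields.BalabanUV.Beta.GAN24.CombForcingTransport (locStencil₂_zero zmode_combForcing_eq_bm_transport)
open Summit.QuantumFields.BalabanUV.Beta.GAN24.DressedSourceZeroModeWords (zmode_dressedSource_inl_inl)
open Summit.QuantumFields.BalabanUV.Beta.GAN24.BiStencilZeroMode (Tab zmode)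
open Summit.QuantumFields.BalabanUV.Beta.GAN24.CombesThomas (sfStep smStep)

namespace Summit.QuantumFields.BalabanUV.Beta.GAN24.CombForcingTwoFaceWords

variable {d : ℕ}

/-! ## §1 Transport sockets -/

section Sockets

variable {n : ℕ} (hn : 0 < n) {r : Fin (d + 1) → ℕ} (hr : r ∈ box (d + 1) n)
include hn hr

/-- [folklore] **THE LEG TRANSPORT KEEPS VERTEX FAMILIES**: `VertexFamily M n CM δ` (`0 < δ`) ⟹ `VertexFamily (ρ w ↦ Ψ̂ᵀ ∘ M ρ w ∘ Ψ̂) n C′ (δ∕4)` with an explicit `C′`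
(`biLoc_comp_decays` with `Ψ̂ᵀ` at half rate, `biLoc_comp_right` with `Ψ̂` at quarter rate — road-P2 M.43's `locStencil_transportPsiS` pattern at the coarse centre `n•w`). -/
theorem vertexFamily_transport {M : Fin (d + 1) → Site (d + 1) → MKer (d + 1) (Fib d)} {CM δM : ℝ} (hM : VertexFamily M n CM δM) (hδM : 0 < δM) :
    ∃ C δ : ℝ, 0 < δ ∧ VertexFamily (fun ρ w => comp (comp (trK (psiKS r n)) (M ρ w)) (psiKS r n)) n C δ := by
  obtain ⟨CP, δP, hδP, hPd⟩ := spr_psiKS (d := d) hn hr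
  have hm0 : 0 < min δP δM := lt_min hδP hδM
  have hCM : 0 ≤ CM := (hM 0 0).nonneg (Sum.inl 0)
  have hPtd : Decays (trK (psiKS r n)) (|CP|) (min δP δM) := decays_of_le (decays_trK hPd) (min_le_left δP δM)
  have hPd' : Decays (psiKS r n) (|CP|) (min δP δM / 2) := decays_of_le hPd (by linarith [min_le_left δP δM])
  have key : ∀ ρ w, BiLoc (comp (comp (trK (psiKS r n)) (M ρ w)) (psiKS r n)) ((n : ℤ) • w) ((n : ℤ) • w) _ (min δP δM / 4) :=
    fun ρ w => biLoc_comp_right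
      (biLoc_comp_decays hPtd (biLoc_mono (hM ρ w) hCM (min_le_right δP δM)) (show 0 ≤ min δP δM / 2 by positivity) (by linarith))
      hPd' (show 0 ≤ min δP δM / 4 by positivity) (by linarith)
  exact ⟨_, _, by positivity, key⟩

/-- [folklore] **THE SLOT-AND-LEG TRANSPORT KEEPS `LocStencilFM`**: `LocStencilFM n M₂ C δ` (`0 < δ`) ⟹ `LocStencilFM n (κ u ρ w ↦ Ψ̂ᵀ ∘ (slotPsiS r n M₂) κ u ρ w ∘ Ψ̂) C′ (δ∕4)`
(d1-leaf-03's `locStencilFM_slotPsiS` on the field slot, then the two leg compositions; the coarse factor `e^{−δ|u − n•w|}` is carried through and weakened to rate `δ∕4`). -/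
theorem locStencilFM_transport {M₂ : Fin (d + 1) → Site (d + 1) → Fin (d + 1) → Site (d + 1) → MKer (d + 1) (Fib d)} {CF δF : ℝ} (hM₂ : LocStencilFM n M₂ CF δF)
    (hδF : 0 < δF) :
    ∃ C δ : ℝ, 0 < δ ∧ LocStencilFM n (fun κ u ρ w => comp (comp (trK (psiKS r n)) (slotPsiS r n M₂ κ u ρ w)) (psiKS r n)) C δ := by
  obtain ⟨CP, δP, hδP, hPd⟩ := spr_psiKS (d := d) hn hr
  have hT := locStencilFM_slotPsiS (d := d) hn r hM₂ hδF.le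
  set CT : ℝ := CF * (1 + SymCorrectorFace.faceWtSum r n * (((d + 1 : ℕ) : ℝ) * (2 * (n : ℝ) ^ (d + 1))) * Real.exp (δF * (3 * (((d + 1 : ℕ) : ℝ) * n)))) with hCT
  have hCT0 : 0 ≤ CT := hT.nonneg
  set m : ℝ := min δP δF with hm
  have hm0 : 0 < m := lt_min hδP hδF
  have hPtd : Decays (trK (psiKS r n)) (|CP|) m := decays_of_le (decays_trK hPd) (min_le_left δP δF)
  have hPd' : Decays (psiKS r n) (|CP|) (m / 2) := decays_of_le hPd (by linarith [min_le_left δP δF])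
  refine ⟨(Fintype.card (Fib d) : ℝ) * ((Fintype.card (Fib d) : ℝ) * (|CP| * CT) * Zl (d + 1) (m - m / 2) * |CP|) * Zl (d + 1) (m / 2 - m / 4), m / 4,
    by positivity, fun κ u ρ w => ?_⟩
  -- the slice at `(κ,u;ρ,w)`: bi-localised at `u` with the coarse factor, at rate `m`
  have h0 : BiLoc (slotPsiS r n M₂ κ u ρ w) u u (CT * Real.exp (-m * l1 (u - (n : ℤ) • w))) m := by
    intro p q a b
    refine (hT κ u ρ w p q a b).trans ?_
    have e1 : Real.exp (-δF * l1 (u - (n : ℤ) • w)) ≤ Real.exp (-m * l1 (u - (n : ℤ) • w)) :=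
      Real.exp_le_exp.2 (by nlinarith [l1_nonneg (u - (n : ℤ) • w), min_le_right δP δF])
    have e2 : Real.exp (-δF * (l1 (p - u) + l1 (q - u))) ≤ Real.exp (-m * (l1 (p - u) + l1 (q - u))) :=
      Real.exp_le_exp.2 (by nlinarith [l1_nonneg (p - u), l1_nonneg (q - u), min_le_right δP δF])
    exact mul_le_mul (mul_le_mul_of_nonneg_left e1 hCT0) e2 (Real.exp_pos _).le (by positivity)
  have h1 := biLoc_comp_right (biLoc_comp_decays hPtd h0 (show 0 ≤ m / 2 by positivity) (by linarith)) hPd' (show 0 ≤ m / 4 by positivity) (by linarith)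
  intro p q a b
  refine (h1 p q a b).trans (mul_le_mul_of_nonneg_right ?_ (Real.exp_pos _).le)
  have e3 : Real.exp (-m * l1 (u - (n : ℤ) • w)) ≤ Real.exp (-(m / 4) * l1 (u - (n : ℤ) • w)) := Real.exp_le_exp.2 (by nlinarith [l1_nonneg (u - (n : ℤ) • w)])
  have hZ1 : 0 ≤ Zl (d + 1) (m - m / 2) := Zl_nonneg (by linarith)
  have hZ2 : 0 ≤ Zl (d + 1) (m / 2 - m / 4) := Zl_nonneg (by linarith)
  calc (Fintype.card (Fib d) : ℝ) * ((Fintype.card (Fib d) : ℝ) * (|CP| * (CT * Real.exp (-m * l1 (u - (n : ℤ) • w)))) * Zl (d + 1) (m - m / 2) * |CP|) * Zl (d + 1) (m / 2 - m / 4)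
      = (Fintype.card (Fib d) : ℝ) * ((Fintype.card (Fib d) : ℝ) * (|CP| * CT) * Zl (d + 1) (m - m / 2) * |CP|) * Zl (d + 1) (m / 2 - m / 4) * Real.exp (-m * l1 (u - (n : ℤ) • w)) := by
        ring
    _ ≤ _ := mul_le_mul_of_nonneg_left e3 (by positivity)

end Sockets

/-! ## §1b The four sockets of the bm functional on the transported comb tables (any record, any units, every level) -/

section Comb

variable {Lc : ℕ} [NeZero Lc]

/-- [folklore] `X̃_i = unitK s_f s_m (coDressKBmAt ρ_c Lc (KInvStep Lc i))` is spread (an2's `decays_coDressKBmAt_KInvStep` through the units). -/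
theorem spr_unitK_bm (sf sm : ℝ) (i : ℕ) : Spr (unitK sf sm (coDressKBmAt (ctr (d + 1) Lc) Lc (KInvStep (d := d) Lc i))) := by
  obtain ⟨δ, C, hδ, -, hG⟩ := decays_coDressKBmAt_KInvStep (d := d) (Lc := Lc) (ctrOff_mem_box (Nat.pos_of_ne_zero (NeZero.ne Lc))) i
  exact ⟨_, δ, hδ, decays_unitK (sf := sf) (sm := sm) hG⟩

/-- [folklore] `𝒯S̃′_i` is a local stencil family (leaf-02 g78's root letter ⨾ road-P2 M.43 `locStencil_transportPsiS`). -/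
theorem exists_locStencil_transport_S (tabs : SymTables d Lc) (sf sm cE cVH cΛ : ℝ) (i : ℕ) :
    ∃ Cs δs : ℝ, 0 < δs ∧ LocStencil (fun κ u => comp (comp (trK (psiKS (ctrOff (d + 1) Lc) Lc)) (slotPsiS (ctrOff (d + 1) Lc) Lc (unitS sf sm (SpureCombOf tabs cE cVH cΛ i)) κ u)) (psiKS (ctrOff (d + 1) Lc) Lc)) Cs δs := by
  obtain ⟨Cs, δs, hδs, hS⟩ := exists_locStencil_unitS_SpureCombOf tabs sf sm cE cVH cΛ i
  exact locStencil_transportPsiS (Nat.pos_of_ne_zero (NeZero.ne Lc)) (ctrOff_mem_box (Nat.pos_of_ne_zero (NeZero.ne Lc))) hS hδs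

/-- [folklore] `𝒯′M̃′_i` is a multiplier vertex family (leaf-02 g78's root letter ⨾ `vertexFamily_transport`). -/
theorem exists_vertexFamily_transport_M (tabs : SymTables d Lc) (sf sm : ℝ) (i : ℕ) :
    ∃ CM δM : ℝ, 0 < δM ∧ VertexFamily (fun ρ w => comp (comp (trK (psiKS (ctrOff (d + 1) Lc) Lc)) (unitM sf sm (tabs.M i) ρ w)) (psiKS (ctrOff (d + 1) Lc) Lc)) Lc CM δM := by
  obtain ⟨CM, δM, hδM, hM⟩ := exists_vertexFamily_unitM_tabs tabs sf sm i
  exact vertexFamily_transport (Nat.pos_of_ne_zero (NeZero.ne Lc)) (ctrOff_mem_box (Nat.pos_of_ne_zero (NeZero.ne Lc))) hM hδM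

/-- [folklore] `𝒯₂M̃₂′_i` is a `LocStencilFM` table (leaf-02 g78's root letter ⨾ `locStencilFM_transport`). -/
theorem exists_locStencilFM_transport_M₂ (tabs : SymTables d Lc) (sf sm : ℝ) (i : ℕ) :
    ∃ C₂ δ₂ : ℝ, 0 < δ₂ ∧ LocStencilFM Lc (fun κ u ρ w => comp (comp (trK (psiKS (ctrOff (d + 1) Lc) Lc)) (slotPsiS (ctrOff (d + 1) Lc) Lc (unitM₂ sf sm (M2Of d Lc tabs.mixFF i)) κ u ρ w)) (psiKS (ctrOff (d + 1) Lc) Lc)) C₂ δ₂ := by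
  obtain ⟨C₂, δ₂, hδ₂, hM₂⟩ := exists_locStencilFM_unitM₂_M2Of_tabs tabs sf sm i
  exact locStencilFM_transport (Nat.pos_of_ne_zero (NeZero.ne Lc)) (ctrOff_mem_box (Nat.pos_of_ne_zero (NeZero.ne Lc))) hM₂ hδ₂

/-- [folklore] **21's `hb` SOCKET AT THE COMB DATA**: `dM X̃_i Lc (𝒯S̃′_i) (𝒯′M̃′_i) b` is localised at every bond (d1-leaf-03's `loc_dM_of_spr`). -/
theorem loc_dM_bm_transport (tabs : SymTables d Lc) (sf sm cE cVH cΛ : ℝ) (i : ℕ) (κ : Fin (d + 1)) (y : Site (d + 1)) :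
    Loc (dM (unitK sf sm (coDressKBmAt (ctr (d + 1) Lc) Lc (KInvStep (d := d) Lc i))) Lc
      (fun κ u => comp (comp (trK (psiKS (ctrOff (d + 1) Lc) Lc)) (slotPsiS (ctrOff (d + 1) Lc) Lc (unitS sf sm (SpureCombOf tabs cE cVH cΛ i)) κ u)) (psiKS (ctrOff (d + 1) Lc) Lc))
      (fun ρ w => comp (comp (trK (psiKS (ctrOff (d + 1) Lc) Lc)) (unitM sf sm (tabs.M i) ρ w)) (psiKS (ctrOff (d + 1) Lc) Lc)) κ y) := by
  obtain ⟨Cs, δs, hδs, hS⟩ := exists_locStencil_transport_S tabs sf sm cE cVH cΛ i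
  obtain ⟨CM, δM, hδM, hM⟩ := exists_vertexFamily_transport_M tabs sf sm i
  exact loc_dM_of_spr (spr_unitK_bm sf sm i) hS hδs hM hδM κ y

/-- [folklore] **21's `hW` SOCKET AT THE COMB DATA**: the transported forcing carrier `W2SymOfK X̃_i Lc (𝒯S̃′_i) (𝒯′M̃′_i) 0 (𝒯₂M̃₂′_i)` is localised slice by slice (an1's
`vertexFamily₂_W2SymOfK'`). -/
theorem loc_W2SymOfK_bm_transport (tabs : SymTables d Lc) (sf sm cE cVH cΛ : ℝ) (i : ℕ) (μ : Fin (d + 1)) (y : Site (d + 1)) (ν : Fin (d + 1)) (y' : Site (d + 1)) :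
    Loc (W2SymOfK (unitK sf sm (coDressKBmAt (ctr (d + 1) Lc) Lc (KInvStep (d := d) Lc i))) Lc
      (fun κ u => comp (comp (trK (psiKS (ctrOff (d + 1) Lc) Lc)) (slotPsiS (ctrOff (d + 1) Lc) Lc (unitS sf sm (SpureCombOf tabs cE cVH cΛ i)) κ u)) (psiKS (ctrOff (d + 1) Lc) Lc))
      (fun ρ w => comp (comp (trK (psiKS (ctrOff (d + 1) Lc) Lc)) (unitM sf sm (tabs.M i) ρ w)) (psiKS (ctrOff (d + 1) Lc) Lc))
      0 (fun κ u ρ w => comp (comp (trK (psiKS (ctrOff (d + 1) Lc) Lc)) (slotPsiS (ctrOff (d + 1) Lc) Lc (unitM₂ sf sm (M2Of d Lc tabs.mixFF i)) κ u ρ w)) (psiKS (ctrOff (d + 1) Lc) Lc)) μ y ν y') := by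
  obtain ⟨Cs, δs, hδs, hS⟩ := exists_locStencil_transport_S tabs sf sm cE cVH cΛ i
  obtain ⟨CM, δM, hδM, hM⟩ := exists_vertexFamily_transport_M tabs sf sm i
  obtain ⟨C₂, δ₂, hδ₂, hM₂⟩ := exists_locStencilFM_transport_M₂ tabs sf sm i
  obtain ⟨C, δ, hδ, hKd⟩ := spr_unitK_bm (d := d) (Lc := Lc) sf sm i
  obtain ⟨Cw, δw, hδw, hW⟩ := vertexFamily₂_W2SymOfK' (N := Lc) ⟨δ, |C|, hδ, abs_nonneg C, decays_of_le hKd le_rfl⟩ hS hδs hM hδM (locStencil₂_zero (d := d) 1) one_pos hM₂ hδ₂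
  exact loc_of_vertexFamily₂ hW hδw μ y ν y'

/-! ## §2 leaf-04's 21 at the comb data -/

/-- NOT IN PRINT; OUR BOOKKEEPING ([folklore]; 21 AT THE COMB DATA).  **THE ff CELL CHARGE OF THE COMB-CHART FORCING IS A CELL-AND-LATTICE SUM OF THREE TWO-FACE WORDS OF THE bm CHART ON
TRANSPORTED TABLES**: for ANY `tabs : SymTables d Lc`, ANY units `s_f s_m`, pins `cE cVH cΛ`, scalars `c cB`, ANY border `B` with zero ff block, every level `i`, period `N`, directions `μ ν α β`:
`zmode N (c • mmRead Lc (K3OfK X̃′_i Lc S̃′_i M̃′_i (W2SymOfK X̃′_i Lc S̃′_i M̃′_i 0 M̃₂′_i)) + cB • B) (μ,ν; inl α, inl β) = c·(−(s_f s_m σ_i)²·Lc²)·Σ_{u ∈ box N} Σ'_{u′} ( FF[(dM_{(μ,u)} ∘ X̃_i) ∘ dM_{(ν,u′)}]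
+ FF[(dM_{(ν,u′)} ∘ X̃_i) ∘ dM_{(μ,u)}] − FF[W̃_{(μ,u)(ν,u′)}] )`, `dM_b = dM X̃_i Lc (𝒯S̃′_i) (𝒯′M̃′_i) b`, `W̃ = W2SymOfK X̃_i Lc (𝒯S̃′_i) (𝒯′M̃′_i) 0 (𝒯₂M̃₂′_i)`, `σ_i = (Lc^{i+1})^{−(d+2)}`
(`CombForcingTransport.zmode_combForcing_eq_bm_transport` ⨾ `DressedSourceZeroModeWords.zmode_dressedSource_inl_inl` at `r := ctrOff (d+1) Lc`, `ρ_c = toSite r` by `rfl`, with §1b's sockets). -/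
theorem zmode_combForcing_inl_inl (tabs : SymTables d Lc) (sf sm cE cVH cΛ c cB : ℝ) {B : Tab d}
    (hBff : ∀ κ u κ' u' x z (α β : Fin (d + 1)), B κ u κ' u' x z (Sum.inl α) (Sum.inl β) = 0) (i N : ℕ) (μ ν α β : Fin (d + 1)) :
    zmode N (fun κ u κ' u' => c • mmRead Lc (K3OfK (unitK sf sm (GcombSh (d := d) Lc i)) Lc (unitS sf sm (SpureCombOf tabs cE cVH cΛ i)) (unitM sf sm (tabs.M i))
        (W2SymOfK (unitK sf sm (GcombSh (d := d) Lc i)) Lc (unitS sf sm (SpureCombOf tabs cE cVH cΛ i)) (unitM sf sm (tabs.M i)) 0 (unitM₂ sf sm (M2Of d Lc tabs.mixFF i))) κ u κ' u') + cB • B κ u κ' u') μ ν (Sum.inl α) (Sum.inl β)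
      = c * (-((sf * sm * ((((Lc ^ (i + 1) : ℕ) : ℝ)) ^ (d + 1 + 1))⁻¹) * (sf * sm * ((((Lc ^ (i + 1) : ℕ) : ℝ)) ^ (d + 1 + 1))⁻¹)) * ((Lc : ℝ) * (Lc : ℝ))) *
        ∑ u ∈ box (d + 1) N, ∑' u' : Site (d + 1),
          ((∑' yw : Site (d + 1) × Site (d + 1), (if yw.1 α % (Lc : ℤ) = (Lc : ℤ) - 1 then (1 : ℝ) else 0) * (if yw.2 β % (Lc : ℤ) = (Lc : ℤ) - 1 then (1 : ℝ) else 0) *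
              comp (comp (dM (unitK sf sm (coDressKBmAt (ctr (d + 1) Lc) Lc (KInvStep (d := d) Lc i))) Lc
                  (fun κ u => comp (comp (trK (psiKS (ctrOff (d + 1) Lc) Lc)) (slotPsiS (ctrOff (d + 1) Lc) Lc (unitS sf sm (SpureCombOf tabs cE cVH cΛ i)) κ u)) (psiKS (ctrOff (d + 1) Lc) Lc))
                  (fun ρ w => comp (comp (trK (psiKS (ctrOff (d + 1) Lc) Lc)) (unitM sf sm (tabs.M i) ρ w)) (psiKS (ctrOff (d + 1) Lc) Lc)) μ (toSite u)) (unitK sf sm (coDressKBmAt (ctr (d + 1) Lc) Lc (KInvStep (d := d) Lc i))))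
                (dM (unitK sf sm (coDressKBmAt (ctr (d + 1) Lc) Lc (KInvStep (d := d) Lc i))) Lc
                  (fun κ u => comp (comp (trK (psiKS (ctrOff (d + 1) Lc) Lc)) (slotPsiS (ctrOff (d + 1) Lc) Lc (unitS sf sm (SpureCombOf tabs cE cVH cΛ i)) κ u)) (psiKS (ctrOff (d + 1) Lc) Lc))
                  (fun ρ w => comp (comp (trK (psiKS (ctrOff (d + 1) Lc) Lc)) (unitM sf sm (tabs.M i) ρ w)) (psiKS (ctrOff (d + 1) Lc) Lc)) ν u') yw.1 yw.2 (Sum.inl α) (Sum.inl β)) +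
            (∑' yw : Site (d + 1) × Site (d + 1), (if yw.1 α % (Lc : ℤ) = (Lc : ℤ) - 1 then (1 : ℝ) else 0) * (if yw.2 β % (Lc : ℤ) = (Lc : ℤ) - 1 then (1 : ℝ) else 0) *
              comp (comp (dM (unitK sf sm (coDressKBmAt (ctr (d + 1) Lc) Lc (KInvStep (d := d) Lc i))) Lc
                  (fun κ u => comp (comp (trK (psiKS (ctrOff (d + 1) Lc) Lc)) (slotPsiS (ctrOff (d + 1) Lc) Lc (unitS sf sm (SpureCombOf tabs cE cVH cΛ i)) κ u)) (psiKS (ctrOff (d + 1) Lc) Lc))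
                  (fun ρ w => comp (comp (trK (psiKS (ctrOff (d + 1) Lc) Lc)) (unitM sf sm (tabs.M i) ρ w)) (psiKS (ctrOff (d + 1) Lc) Lc)) ν u') (unitK sf sm (coDressKBmAt (ctr (d + 1) Lc) Lc (KInvStep (d := d) Lc i))))
                (dM (unitK sf sm (coDressKBmAt (ctr (d + 1) Lc) Lc (KInvStep (d := d) Lc i))) Lc
                  (fun κ u => comp (comp (trK (psiKS (ctrOff (d + 1) Lc) Lc)) (slotPsiS (ctrOff (d + 1) Lc) Lc (unitS sf sm (SpureCombOf tabs cE cVH cΛ i)) κ u)) (psiKS (ctrOff (d + 1) Lc) Lc))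
                  (fun ρ w => comp (comp (trK (psiKS (ctrOff (d + 1) Lc) Lc)) (unitM sf sm (tabs.M i) ρ w)) (psiKS (ctrOff (d + 1) Lc) Lc)) μ (toSite u)) yw.1 yw.2 (Sum.inl α) (Sum.inl β)) -
            ∑' yw : Site (d + 1) × Site (d + 1), (if yw.1 α % (Lc : ℤ) = (Lc : ℤ) - 1 then (1 : ℝ) else 0) * (if yw.2 β % (Lc : ℤ) = (Lc : ℤ) - 1 then (1 : ℝ) else 0) *
              (W2SymOfK (unitK sf sm (coDressKBmAt (ctr (d + 1) Lc) Lc (KInvStep (d := d) Lc i))) Lc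
                (fun κ u => comp (comp (trK (psiKS (ctrOff (d + 1) Lc) Lc)) (slotPsiS (ctrOff (d + 1) Lc) Lc (unitS sf sm (SpureCombOf tabs cE cVH cΛ i)) κ u)) (psiKS (ctrOff (d + 1) Lc) Lc))
                (fun ρ w => comp (comp (trK (psiKS (ctrOff (d + 1) Lc) Lc)) (unitM sf sm (tabs.M i) ρ w)) (psiKS (ctrOff (d + 1) Lc) Lc))
                0 (fun κ u ρ w => comp (comp (trK (psiKS (ctrOff (d + 1) Lc) Lc)) (slotPsiS (ctrOff (d + 1) Lc) Lc (unitM₂ sf sm (M2Of d Lc tabs.mixFF i)) κ u ρ w)) (psiKS (ctrOff (d + 1) Lc) Lc))) μ (toSite u) ν u' yw.1 yw.2 (Sum.inl α) (Sum.inl β)) := by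
  have hLc : 0 < Lc := Nat.pos_of_ne_zero (NeZero.ne Lc)
  rw [zmode_combForcing_eq_bm_transport]
  exact zmode_dressedSource_inl_inl hLc (ctrOff_mem_box hLc) sf sm i c cB (loc_dM_bm_transport tabs sf sm cE cVH cΛ i)
    (loc_W2SymOfK_bm_transport tabs sf sm cE cVH cΛ i) hBff N μ ν α β

end Comb

/-! ## §3 `d = 3`: `hB0`'s tokens at an1's record -/

section Literal

variable {Lc : ℕ} [NeZero Lc]

/-- NOT IN PRINT; OUR BOOKKEEPING ([folklore]; 21 AT `hB0`'s TOKENS).  **THE ff CELL CHARGE OF `b̃′_i` AT an1's RECORD** (`d = 3`, the wall's units `sfStep Lc i ∕ smStep 3 Lc i`,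
`tabs = symTablesAn1S2 3 Lc cΛt`, `c = cE₂·Lc^{2(3+1)}`, border `tabs.vh₂S` — its ff block is zero by an1's `symVh₂SAn1_inl_inl`, `rfl`): §2 with nothing displayed — the three two-face words of
the bm chart `X̃_i` on the transported comb tables, every level `i`, period `N`, directions `μ ν α β`. -/
theorem zmode_combForcing_an1_inl_inl (cΛt cE cVH cΛ cE₂ cB : ℝ) (i N : ℕ) (μ ν α β : Fin (3 + 1)) :
    zmode N (fun κ u κ' u' => (cE₂ * (Lc : ℝ) ^ (2 * (3 + 1))) • mmRead Lc (K3OfK (unitK (sfStep Lc i) (smStep 3 Lc i) (GcombSh (d := 3) Lc i)) Lc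
        (unitS (sfStep Lc i) (smStep 3 Lc i) (SpureCombOf (symTablesAn1S2 3 Lc cΛt) cE cVH cΛ i)) (unitM (sfStep Lc i) (smStep 3 Lc i) ((symTablesAn1S2 3 Lc cΛt).M i))
        (W2SymOfK (unitK (sfStep Lc i) (smStep 3 Lc i) (GcombSh (d := 3) Lc i)) Lc (unitS (sfStep Lc i) (smStep 3 Lc i) (SpureCombOf (symTablesAn1S2 3 Lc cΛt) cE cVH cΛ i))
          (unitM (sfStep Lc i) (smStep 3 Lc i) ((symTablesAn1S2 3 Lc cΛt).M i)) 0 (unitM₂ (sfStep Lc i) (smStep 3 Lc i) (M2Of 3 Lc (symTablesAn1S2 3 Lc cΛt).mixFF i))) κ u κ' u')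
        + cB • (symTablesAn1S2 3 Lc cΛt).vh₂S κ u κ' u') μ ν (Sum.inl α) (Sum.inl β)
      = (cE₂ * (Lc : ℝ) ^ (2 * (3 + 1))) *
          (-((sfStep Lc i * smStep 3 Lc i * ((((Lc ^ (i + 1) : ℕ) : ℝ)) ^ (3 + 1 + 1))⁻¹) * (sfStep Lc i * smStep 3 Lc i * ((((Lc ^ (i + 1) : ℕ) : ℝ)) ^ (3 + 1 + 1))⁻¹)) * ((Lc : ℝ) * (Lc : ℝ))) *
        ∑ u ∈ box (3 + 1) N, ∑' u' : Site (3 + 1),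
          ((∑' yw : Site (3 + 1) × Site (3 + 1), (if yw.1 α % (Lc : ℤ) = (Lc : ℤ) - 1 then (1 : ℝ) else 0) * (if yw.2 β % (Lc : ℤ) = (Lc : ℤ) - 1 then (1 : ℝ) else 0) *
              comp (comp (dM (unitK (sfStep Lc i) (smStep 3 Lc i) (coDressKBmAt (ctr (3 + 1) Lc) Lc (KInvStep (d := 3) Lc i))) Lc
                  (fun κ u => comp (comp (trK (psiKS (ctrOff (3 + 1) Lc) Lc)) (slotPsiS (ctrOff (3 + 1) Lc) Lc (unitS (sfStep Lc i) (smStep 3 Lc i) (SpureCombOf (symTablesAn1S2 3 Lc cΛt) cE cVH cΛ i)) κ u)) (psiKS (ctrOff (3 + 1) Lc) Lc))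
                  (fun ρ w => comp (comp (trK (psiKS (ctrOff (3 + 1) Lc) Lc)) (unitM (sfStep Lc i) (smStep 3 Lc i) ((symTablesAn1S2 3 Lc cΛt).M i) ρ w)) (psiKS (ctrOff (3 + 1) Lc) Lc)) μ (toSite u))
                (unitK (sfStep Lc i) (smStep 3 Lc i) (coDressKBmAt (ctr (3 + 1) Lc) Lc (KInvStep (d := 3) Lc i))))
                (dM (unitK (sfStep Lc i) (smStep 3 Lc i) (coDressKBmAt (ctr (3 + 1) Lc) Lc (KInvStep (d := 3) Lc i))) Lc
                  (fun κ u => comp (comp (trK (psiKS (ctrOff (3 + 1) Lc) Lc)) (slotPsiS (ctrOff (3 + 1) Lc) Lc (unitS (sfStep Lc i) (smStep 3 Lc i) (SpureCombOf (symTablesAn1S2 3 Lc cΛt) cE cVH cΛ i)) κ u)) (psiKS (ctrOff (3 + 1) Lc) Lc))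
                  (fun ρ w => comp (comp (trK (psiKS (ctrOff (3 + 1) Lc) Lc)) (unitM (sfStep Lc i) (smStep 3 Lc i) ((symTablesAn1S2 3 Lc cΛt).M i) ρ w)) (psiKS (ctrOff (3 + 1) Lc) Lc)) ν u') yw.1 yw.2 (Sum.inl α) (Sum.inl β)) +
            (∑' yw : Site (3 + 1) × Site (3 + 1), (if yw.1 α % (Lc : ℤ) = (Lc : ℤ) - 1 then (1 : ℝ) else 0) * (if yw.2 β % (Lc : ℤ) = (Lc : ℤ) - 1 then (1 : ℝ) else 0) *
              comp (comp (dM (unitK (sfStep Lc i) (smStep 3 Lc i) (coDressKBmAt (ctr (3 + 1) Lc) Lc (KInvStep (d := 3) Lc i))) Lc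
                  (fun κ u => comp (comp (trK (psiKS (ctrOff (3 + 1) Lc) Lc)) (slotPsiS (ctrOff (3 + 1) Lc) Lc (unitS (sfStep Lc i) (smStep 3 Lc i) (SpureCombOf (symTablesAn1S2 3 Lc cΛt) cE cVH cΛ i)) κ u)) (psiKS (ctrOff (3 + 1) Lc) Lc))
                  (fun ρ w => comp (comp (trK (psiKS (ctrOff (3 + 1) Lc) Lc)) (unitM (sfStep Lc i) (smStep 3 Lc i) ((symTablesAn1S2 3 Lc cΛt).M i) ρ w)) (psiKS (ctrOff (3 + 1) Lc) Lc)) ν u')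
                (unitK (sfStep Lc i) (smStep 3 Lc i) (coDressKBmAt (ctr (3 + 1) Lc) Lc (KInvStep (d := 3) Lc i))))
                (dM (unitK (sfStep Lc i) (smStep 3 Lc i) (coDressKBmAt (ctr (3 + 1) Lc) Lc (KInvStep (d := 3) Lc i))) Lc
                  (fun κ u => comp (comp (trK (psiKS (ctrOff (3 + 1) Lc) Lc)) (slotPsiS (ctrOff (3 + 1) Lc) Lc (unitS (sfStep Lc i) (smStep 3 Lc i) (SpureCombOf (symTablesAn1S2 3 Lc cΛt) cE cVH cΛ i)) κ u)) (psiKS (ctrOff (3 + 1) Lc) Lc))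
                  (fun ρ w => comp (comp (trK (psiKS (ctrOff (3 + 1) Lc) Lc)) (unitM (sfStep Lc i) (smStep 3 Lc i) ((symTablesAn1S2 3 Lc cΛt).M i) ρ w)) (psiKS (ctrOff (3 + 1) Lc) Lc)) μ (toSite u)) yw.1 yw.2 (Sum.inl α) (Sum.inl β)) -
            ∑' yw : Site (3 + 1) × Site (3 + 1), (if yw.1 α % (Lc : ℤ) = (Lc : ℤ) - 1 then (1 : ℝ) else 0) * (if yw.2 β % (Lc : ℤ) = (Lc : ℤ) - 1 then (1 : ℝ) else 0) *
              W2SymOfK (unitK (sfStep Lc i) (smStep 3 Lc i) (coDressKBmAt (ctr (3 + 1) Lc) Lc (KInvStep (d := 3) Lc i))) Lc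
                (fun κ u => comp (comp (trK (psiKS (ctrOff (3 + 1) Lc) Lc)) (slotPsiS (ctrOff (3 + 1) Lc) Lc (unitS (sfStep Lc i) (smStep 3 Lc i) (SpureCombOf (symTablesAn1S2 3 Lc cΛt) cE cVH cΛ i)) κ u)) (psiKS (ctrOff (3 + 1) Lc) Lc))
                (fun ρ w => comp (comp (trK (psiKS (ctrOff (3 + 1) Lc) Lc)) (unitM (sfStep Lc i) (smStep 3 Lc i) ((symTablesAn1S2 3 Lc cΛt).M i) ρ w)) (psiKS (ctrOff (3 + 1) Lc) Lc))
                0 (fun κ u ρ w => comp (comp (trK (psiKS (ctrOff (3 + 1) Lc) Lc)) (slotPsiS (ctrOff (3 + 1) Lc) Lc (unitM₂ (sfStep Lc i) (smStep 3 Lc i) (M2Of 3 Lc (symTablesAn1S2 3 Lc cΛt).mixFF i)) κ u ρ w)) (psiKS (ctrOff (3 + 1) Lc) Lc)) μ (toSite u) ν u' yw.1 yw.2 (Sum.inl α) (Sum.inl β)) :=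
  zmode_combForcing_inl_inl (symTablesAn1S2 3 Lc cΛt) (sfStep Lc i) (smStep 3 Lc i) cE cVH cΛ (cE₂ * (Lc : ℝ) ^ (2 * (3 + 1))) cB (fun _ _ _ _ _ _ _ _ => rfl) i N μ ν α β

end Literal

end Summit.QuantumFields.BalabanUV.Beta.GAN24.CombForcingTwoFaceWords

end
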